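import Summits.HodgeConjecture.CorCM.LefschetzAlgebraCMCentre
import Literature.AlgebraicGeometry.ComplexMultiplication.CenterEndAlgebraTotallyRealOrCMOfRiemann
import Mathlib.NumberTheory.NumberField.CMField
import Literature.AlgebraicGeometry.ComplexMultiplication.EndFieldTotallyRealOrCMOfRiemann
import Literature.AlgebraicGeometry.HodgeTheory.AbelianVarietyHodgeFullnessHolds
import Literature.AlgebraicGeometry.Pohlmann1968.SimpleCMAbelianVarietyHazamaCriterion
import HarnessLib

/-!
# `End⁰B` a CM field: `2 · dim Lef(ψ) = dim C(End_Hdg(H¹B))` for every polarization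

Sub-problem `CorCM` of `HodgeConjecture` (cell `pub-hodgecm2`, count-neutral Mumford–Tate-rank lane of seat `b27`; theorems only,
no new definition, no named fact; nothing here uses or asserts `HC_CM`).  The intrinsic form of `CorCM/LefschetzAlgebraCMCentre`:
for a complex abelian variety `B` of positive dimension whose endomorphism algebra IS a CM field `K` (`φ : K → End⁰B` a bijective
ring homomorphism, Mathlib's `NumberField.IsCMField K`) — Albert type IV(e₀, 1), e.g. simple CM abelian varieties, abelian varieties
of Weil type, elliptic curves with complex multiplication — and every polarization `ψ` of `H¹(B, ℚ)`:

  **`2 · dim_ℚ (C(End_Hdg(H¹B)) ∩ 𝔰𝔭(ψ)) = dim_ℚ C(End_Hdg(H¹B))`**, hence **`2 · dim Lie Hg(H¹B) ≤ dim_ℚ C(End_Hdg(H¹B))`**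

(`Lef(ψ) = U(H¹B/K, φ_ψ)`, `C(End_Hdg) = Res_{K/ℚ} 𝔤𝔩_K(H¹B)`; Milne 1999 §2, type IV).  PROOF: the Rosati involution of `ψ`
is complex conjugation on `K` (Shimura §5.1 Lemma 2 on `H¹`, the tree's `apply_eq_conj_of_isAdjointPair'`), so it fixes the
maximal real subfield `K⁺` (Mathlib `NumberField.maximalRealSubfield`, `mem_maximalRealSubfield_iff`) and negates
`ι = x − x̄` (`x ∉ K⁺`, Mathlib `IsCMField.complexConj`); `K = K⁺ ⊕ K⁺ι` (`z = (z + z̄)/2 + ((z − z̄)/2ι) ι`), `ι² ∈ K⁺`; then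
`CorCM/LefschetzAlgebraCMCentre` over `K⁺`.  §0 computes `dim_ℚ C(End_Hdg) = [K:ℚ] · m²` (`m = dim_K H¹B`) for any number
field `K = End⁰B`, so that **`2 · dim Lef(ψ) = [K:ℚ] · m²`** (Milne's `e₀ m²`) and **`2 · dim Lie Hg ≤ [K:ℚ] · m²`**
(`exists_two_mul_finrank_lefschetz_eq_of_isCMField`).  §2: `[K:ℚ] = 2 dim B` (simple CM type) ⟹ `dim Lef(ψ) = dim B` and
**Hodge = Lefschetz ⟺ `t = dim B + 1` (nondegenerate CM type)**; `[K:ℚ] = 2` (Weil type) ⟹ `dim Lef(ψ) = (dim B)²`, `t ≤ (dim B)² + 1`.  §3: intrinsically, **a SIMPLE abelian variety of CM type has `dim Lef(ψ) = dim B` and Hodge = Lefschetz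
⟺ `t = dim B + 1`** (`hodgeLie_eq_lefschetz_iff_of_isSimple_of_isOfCMType`); in dimension `≤ 3` or prime dimension this holds
(Ribet 1980, Yanai 1985: `hodgeLie_eq_lefschetz_of_isSimple_of_isOfCMType_of_dim_le_three_or_prime`).

## References
* [Milne1999LefschetzClasses] J. S. Milne, *Lefschetz classes on abelian varieties*, Duke Math. J. 96 (1999), §2 (type IV) and Summary.
* [Shimura1998] G. Shimura, *Abelian Varieties with Complex Multiplication and Modular Functions* (1998), §5.1 Lemma 2, Prop. 5.
* [MoonenZarhin1999LowDim] B. Moonen, Yu. G. Zarhin, Math. Ann. 315 (1999), §1, (2.2), (2.4) (`Hg ⊆ U_F` for type IV).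
-/

noncomputable section

namespace Summit.HodgeConjecture.CorCM

open scoped TensorProduct ComplexConjugate
open CategoryTheory CategoryTheory.Limits Module NumberField
open Literature.AlgebraicGeometry.Motives
open Literature.AlgebraicGeometry.Motives.AbelianVariety
open Literature.AlgebraicGeometry.Motives.HodgeStructure
open Literature.AlgebraicGeometry.HodgeTheory
open Literature.AlgebraicGeometry.ComplexMultiplication (bettiRep bettiRep_injective hOneAlgHom hOneAlgHom_apply
  apply_eq_conj_of_isAdjointPair' EndField EndField.toEndAlgebra isCMField_endField_of_isSimple_of_riemann)
open Literature.AlgebraicGeometry.Milne1999 (IsOfCMType)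


/-! ## §0 The centraliser of a commutative field of Hodge endomorphisms: `dim_ℚ C(End_Hdg) = [K:ℚ] · m²` -/

/-- **`C(End_Hdg(H¹B)) = Res_{K/ℚ} End_K(H¹B)`** when `End⁰B` is a number field `K` (`φ : K → End⁰B` bijective): with
`m = dim_K H¹B` (`[K:ℚ] · m = dim_ℚ H¹B`), **`dim_ℚ C(End_Hdg(H¹B)) = [K:ℚ] · m²`**.  (`H¹B` is a `K`-space through `bettiRep ∘ φ`;
a `ℚ`-endomorphism commutes with `End_Hdg = ρ(φ(K))` iff it is `K`-linear.) [cite: Milne1999LefschetzClasses, §2]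
[cite: MumfordAV1970, §19 Cor. 2 and Thm. 3] -/
theorem exists_finrank_centralizer_endAlg_eq_of_field {B : AbelianVariety ℂ} {K : Type} [Field K] [NumberField K]
    (φ : K →+* B.endAlgebra) (hφ : Function.Bijective φ) [Module.Finite ℚ (bettiCohomology B.X 1)] :
    ∃ m : ℕ, Module.finrank ℚ K * m = Module.finrank ℚ (bettiCohomology B.X 1) ∧
      Module.finrank ℚ ↥(Subalgebra.toSubmodule (Subalgebra.centralizer ℚ
          ((BettiUniverse.hodge exists_isReal_hodgeModel_holds (AbelianVariety.isSmoothProjective_holds (A := B)) 1).endAlg :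
            Set (Module.End ℚ (bettiCohomology B.X 1))))) = Module.finrank ℚ K * (m * m) := by
  classical
  have hHD : exists_isReal_hodgeModel := exists_isReal_hodgeModel_holds
  have hI : hodgePQ_independent_of_hodgeModel := hodgePQ_independent_of_hodgeModel_holds
  let ρ : B.endAlgebra → Module.End ℚ (bettiCohomology B.X 1) := fun z => MulOpposite.unop (bettiRep B z)
  have hρ : ∀ z, ρ z = MulOpposite.unop (bettiRep B z) := fun z => rfl
  have hρmul : ∀ z w, ρ (z * w) = ρ w * ρ z := fun z w => by rw [hρ, hρ, hρ, map_mul, MulOpposite.unop_mul]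
  have hρadd : ∀ z w, ρ (z + w) = ρ z + ρ w := fun z w => by rw [hρ, hρ, hρ, map_add, MulOpposite.unop_add]
  have hρzero : ρ 0 = 0 := by rw [hρ, map_zero, MulOpposite.unop_zero]
  have hρone : ρ 1 = 1 := by rw [hρ, map_one, MulOpposite.unop_one]
  have hρrat : ∀ r : ℚ, ρ (algebraMap ℚ B.endAlgebra r) = r • (1 : Module.End ℚ (bettiCohomology B.X 1)) := fun r => by
    rw [hρ, AlgHom.commutes, MulOpposite.algebraMap_apply, MulOpposite.unop_op, Algebra.algebraMap_eq_smul_one]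
  have hρA : ∀ z, ρ z ∈ (BettiUniverse.hodge exists_isReal_hodgeModel_holds (AbelianVariety.isSmoothProjective_holds (A := B)) 1).endAlg := fun z =>
    Literature.AlgebraicGeometry.ComplexMultiplication.unop_bettiRep_mem_endAlg hHD hI z
  have hφrat : ∀ q : ℚ, φ (algebraMap ℚ K q) = algebraMap ℚ B.endAlgebra q := fun q => by
    rw [← RingHom.comp_apply, Subsingleton.elim (φ.comp (algebraMap ℚ K)) (algebraMap ℚ B.endAlgebra)]
  -- `H¹B` as a `K`-vector space through `ρ ∘ φ`
  let f : K →+* Module.End ℚ (bettiCohomology B.X 1) :=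
    { toFun := fun c => ρ (φ c)
      map_one' := by rw [map_one, hρone]
      map_mul' := fun c c' => by rw [mul_comm c c', map_mul, hρmul]
      map_zero' := by rw [map_zero, hρzero]
      map_add' := fun c c' => by rw [map_add, hρadd] }
  letI : Module K (bettiCohomology B.X 1) := Module.compHom _ f
  have hsmulK : ∀ (c : K) (x : bettiCohomology B.X 1), c • x = ρ (φ c) x := fun c x => rfl
  haveI : IsScalarTower ℚ K (bettiCohomology B.X 1) := ⟨fun q c x => by
    rw [hsmulK, hsmulK, Algebra.smul_def, map_mul, hφrat, hρmul, hρrat, Module.End.mul_apply, LinearMap.smul_apply,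
      Module.End.one_apply, map_smul]⟩
  haveI : Module.Finite K (bettiCohomology B.X 1) := Module.Finite.of_restrictScalars_finite ℚ K _
  obtain ⟨Cq, hCq⟩ : ∃ Cq : Submodule ℚ (Module.End ℚ (bettiCohomology B.X 1)), Cq =
      Subalgebra.toSubmodule (Subalgebra.centralizer ℚ
        ((BettiUniverse.hodge exists_isReal_hodgeModel_holds (AbelianVariety.isSmoothProjective_holds (A := B)) 1).endAlg :
          Set (Module.End ℚ (bettiCohomology B.X 1)))) := ⟨_, rfl⟩
  have hmemCq : ∀ {Y : Module.End ℚ (bettiCohomology B.X 1)}, Y ∈ Cq ↔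
      ∀ g ∈ (BettiUniverse.hodge exists_isReal_hodgeModel_holds (AbelianVariety.isSmoothProjective_holds (A := B)) 1).endAlg,
        g * Y = Y * g := fun {Y} => by
    rw [hCq, Subalgebra.mem_toSubmodule, Subalgebra.mem_centralizer_iff]
    exact Iff.rfl
  rw [← hCq]
  -- `C(End_Hdg) ↪ End_K(H¹B) ↪ C(End_Hdg)`
  have hlift : ∀ Y ∈ Cq, ∃ T : bettiCohomology B.X 1 →ₗ[K] bettiCohomology B.X 1, ∀ x, T x = Y x := by
    intro Y hY
    have hcommY : ∀ z, Y * ρ z = ρ z * Y := fun z => ((hmemCq.1 hY) (ρ z) (hρA z)).symm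
    refine ⟨{ toFun := Y, map_add' := map_add Y, map_smul' := fun c x => ?_ }, fun x => rfl⟩
    rw [RingHom.id_apply, hsmulK, hsmulK, ← Module.End.mul_apply, hcommY, Module.End.mul_apply]
  have hdesc : ∀ T : bettiCohomology B.X 1 →ₗ[K] bettiCohomology B.X 1,
      (T.restrictScalars ℚ : Module.End ℚ (bettiCohomology B.X 1)) ∈ Cq := by
    intro T
    refine hmemCq.2 fun g hg => ?_
    obtain ⟨z, hz⟩ := exists_unop_bettiRep_eq_of_mem_endAlg (AbelianVariety.isSmoothProjective_holds (A := B)) hg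
    obtain ⟨k, rfl⟩ := hφ.2 z
    refine LinearMap.ext fun x => ?_
    rw [Module.End.mul_apply, Module.End.mul_apply, LinearMap.restrictScalars_apply, LinearMap.restrictScalars_apply, ← hz,
      ← hρ, ← hsmulK, ← hsmulK, map_smul]
  choose T hT using hlift
  let Φ : Cq →ₗ[ℚ] (bettiCohomology B.X 1 →ₗ[K] bettiCohomology B.X 1) :=
    { toFun := fun Y => T Y Y.2
      map_add' := fun Y Y' => LinearMap.ext fun x => by
        change T _ (Y + Y').2 x = T Y Y.2 x + T Y' Y'.2 x
        rw [hT, hT, hT]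
        rfl
      map_smul' := fun r Y => LinearMap.ext fun x => by
        change T _ (r • Y).2 x = r • T Y Y.2 x
        rw [hT, hT]
        rfl }
  have hΦ : Function.Injective Φ := by
    intro Y Y' h
    apply Subtype.ext
    refine LinearMap.ext fun x => ?_
    have h' : T Y Y.2 = T Y' Y'.2 := h
    rw [← hT Y Y.2, ← hT Y' Y'.2, h']
  let Ψ : (bettiCohomology B.X 1 →ₗ[K] bettiCohomology B.X 1) →ₗ[ℚ] Cq :=
    { toFun := fun S => ⟨S.restrictScalars ℚ, hdesc S⟩
      map_add' := fun S S' => rfl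
      map_smul' := fun r S => rfl }
  have hΨ : Function.Injective Ψ := by
    intro S S' h
    refine LinearMap.ext fun x => ?_
    exact LinearMap.congr_fun (congrArg Subtype.val h) x
  have hn : Module.finrank ℚ K * Module.finrank K (bettiCohomology B.X 1) = Module.finrank ℚ (bettiCohomology B.X 1) :=
    Module.finrank_mul_finrank ℚ K (bettiCohomology B.X 1)
  refine ⟨Module.finrank K (bettiCohomology B.X 1), hn, ?_⟩
  rw [← Module.finrank_linearMap K K (bettiCohomology B.X 1) (bettiCohomology B.X 1), Module.finrank_mul_finrank]
  exact le_antisymm (LinearMap.finrank_le_finrank_of_injective hΦ) (LinearMap.finrank_le_finrank_of_injective hΨ)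

/-! ## §1 `End⁰B` a CM field -/

/-- **`End⁰B` a CM field ⟹ `2 · dim Lef(ψ) = dim C(End_Hdg(H¹B))`** for every polarization `ψ` of `H¹B` (`B` of positive
dimension, `φ : K → End⁰B` a bijective ring homomorphism from a CM field `K`). [cite: Milne1999LefschetzClasses, §2 and Summary]
[cite: Shimura1998, §5.1 Lemma 2 and Proposition 5] [cite: MoonenZarhin1999LowDim, §1] -/
theorem two_mul_finrank_lefschetz_eq_finrank_centralizer_of_isCMField {B : AbelianVariety ℂ} (hB0 : 0 < B.dim) {K : Type}
    [Field K] [NumberField K] [IsCMField K] (φ : K →+* B.endAlgebra) (hφ : Function.Bijective φ)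
    [Module.Finite ℚ (bettiCohomology B.X 1)]
    (ψ : (BettiUniverse.hodge exists_isReal_hodgeModel_holds (AbelianVariety.isSmoothProjective_holds (A := B)) 1).Polarization) :
    2 * Module.finrank ℚ ↥(Subalgebra.toSubmodule (Subalgebra.centralizer ℚ
          ((BettiUniverse.hodge exists_isReal_hodgeModel_holds (AbelianVariety.isSmoothProjective_holds (A := B)) 1).endAlg :
            Set (Module.End ℚ (bettiCohomology B.X 1)))) ⊓ ψ.form.skewAdjointSubmodule) =
      Module.finrank ℚ ↥(Subalgebra.toSubmodule (Subalgebra.centralizer ℚ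
          ((BettiUniverse.hodge exists_isReal_hodgeModel_holds (AbelianVariety.isSmoothProjective_holds (A := B)) 1).endAlg :
            Set (Module.End ℚ (bettiCohomology B.X 1))))) := by
  classical
  have hHD : exists_isReal_hodgeModel := exists_isReal_hodgeModel_holds
  have hI : hodgePQ_independent_of_hodgeModel := hodgePQ_independent_of_hodgeModel_holds
  -- `End⁰B` is commutative; the `K⁺`-algebra structure on `End⁰B`
  have hcomm : ∀ u v : B.endAlgebra, u * v = v * u := fun u v => by
    obtain ⟨k, rfl⟩ := hφ.2 u
    obtain ⟨l, rfl⟩ := hφ.2 v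
    rw [← map_mul, mul_comm, map_mul]
  set K₀ : Subfield K := maximalRealSubfield K with hK₀
  letI : Algebra K₀ B.endAlgebra := (φ.comp (algebraMap K₀ K)).toAlgebra' fun c x => hcomm _ _
  have halg : ∀ c : K₀, algebraMap K₀ B.endAlgebra c = φ (c : K) := fun c => rfl
  haveI : IsScalarTower ℚ K₀ B.endAlgebra := IsScalarTower.of_algebraMap_eq' (Subsingleton.elim _ _)
  have hmem : ∀ z : K, z ∈ K₀ ↔ ∀ σ : K →+* ℂ, starRingEnd ℂ (σ z) = σ z := fun z => by
    rw [hK₀, mem_maximalRealSubfield_iff]; rfl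
  -- the Rosati involution is complex conjugation on `φ(K)`
  have hconj : ∀ k k' : K, φ k' = AbelianVariety.rosati B exists_isReal_hodgeModel_holds hodgePQ_independent_of_hodgeModel_holds ψ
      (φ k) → ∀ σ : K →+* ℂ, σ k' = starRingEnd ℂ (σ k) := by
    intro k k' hk' σ
    refine apply_eq_conj_of_isAdjointPair' hHD hI hB0 ψ φ (a := k) (a' := k') (fun x y => ?_) σ
    rw [hOneAlgHom_apply, hOneAlgHom_apply, hk', AbelianVariety.unop_bettiRep_rosati, ψ.form_apply_adjoint]
  obtain ⟨σ₀⟩ : Nonempty (K →+* ℂ) := inferInstance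
  have hrosK : ∀ c : K₀, AbelianVariety.rosati B exists_isReal_hodgeModel_holds hodgePQ_independent_of_hodgeModel_holds ψ
      (algebraMap K₀ _ c) = algebraMap K₀ _ c := by
    intro c
    obtain ⟨k', hk'⟩ := hφ.2 (AbelianVariety.rosati B exists_isReal_hodgeModel_holds hodgePQ_independent_of_hodgeModel_holds ψ
      (φ (c : K)))
    rw [halg, ← hk']
    congr 1
    exact σ₀.injective (by rw [hconj (c : K) k' hk' σ₀, (hmem (c : K)).1 c.2 σ₀])
  -- `ι = x − x̄` with `x ∉ K⁺`: Rosati-skew, `ι² ∈ K⁺`, `K = K⁺ ⊕ K⁺ ι`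
  obtain ⟨x, hx⟩ : ∃ x : K, IsCMField.complexConj K x ≠ x := by
    by_contra h
    push Not at h
    exact IsCMField.complexConj_ne_one K (AlgEquiv.ext h)
  set ι : K := x - IsCMField.complexConj K x with hιdef
  have hισ : ∀ σ : K →+* ℂ, starRingEnd ℂ (σ ι) = -σ ι := fun σ => by
    rw [hιdef, map_sub, map_sub, IsCMField.complexEmbedding_complexConj, starRingEnd_self_apply, neg_sub]
  have hι0 : ι ≠ 0 := sub_ne_zero.2 (Ne.symm hx)
  have hι2mem : ι * ι ∈ K₀ := (hmem _).2 fun σ => by rw [map_mul, map_mul, hισ, neg_mul_neg]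
  set a : K₀ := ⟨ι * ι, hι2mem⟩ with hadef
  have ha : a ≠ 0 := fun h => by
    have h' : ι * ι = 0 := by
      have := congrArg Subtype.val h
      exact this
    exact hι0 (mul_self_eq_zero.1 h')
  have hιE : φ ι * φ ι = algebraMap K₀ B.endAlgebra a := by rw [← map_mul, halg]
  have hrosι : AbelianVariety.rosati B exists_isReal_hodgeModel_holds hodgePQ_independent_of_hodgeModel_holds ψ (φ ι) = -φ ι := by
    obtain ⟨k', hk'⟩ := hφ.2 (AbelianVariety.rosati B exists_isReal_hodgeModel_holds hodgePQ_independent_of_hodgeModel_holds ψ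
      (φ ι))
    rw [← hk', ← map_neg]
    congr 1
    exact σ₀.injective (by rw [hconj ι k' hk' σ₀, hισ, map_neg])
  have hgen : ∀ z : B.endAlgebra, ∃ c d : K₀, z = algebraMap K₀ _ c + algebraMap K₀ _ d * φ ι := by
    intro z
    obtain ⟨k, rfl⟩ := hφ.2 z
    have hcmem : (k + IsCMField.complexConj K k) / 2 ∈ K₀ := (hmem _).2 fun σ => by
      simp only [map_div₀, map_add, IsCMField.complexEmbedding_complexConj, starRingEnd_self_apply, map_ofNat]
      rw [add_comm]
    have hdmem : (k - IsCMField.complexConj K k) / 2 * ι⁻¹ ∈ K₀ := (hmem _).2 fun σ => by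
      simp only [map_mul, map_inv₀, map_div₀, map_sub, IsCMField.complexEmbedding_complexConj, starRingEnd_self_apply,
        map_ofNat, hισ]
      rw [inv_neg, mul_neg, ← neg_mul, ← neg_div, neg_sub]
    refine ⟨⟨_, hcmem⟩, ⟨_, hdmem⟩, ?_⟩
    rw [halg, halg, ← map_mul, ← map_add]
    congr 1
    change k = (k + IsCMField.complexConj K k) / 2 + (k - IsCMField.complexConj K k) / 2 * ι⁻¹ * ι
    rw [inv_mul_cancel_right₀ hι0]
    ring
  exact two_mul_finrank_lefschetz_eq_finrank_centralizer_of_cmCentre ψ ha hιE hgen hrosK hrosι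

/-- **`End⁰B` a CM field ⟹ `2 · dim Lie Hg(H¹B) ≤ dim C(End_Hdg(H¹B))`** (`Hg ⊆ U(H¹B/K, φ_ψ)`).
[cite: MoonenZarhin1999LowDim, §1] [cite: Milne1999LefschetzClasses, §2 and Summary] -/
theorem two_mul_finrank_hodgeLie_le_finrank_centralizer_of_isCMField [HodgeTensorFacts.{0, 0}] {B : AbelianVariety ℂ}
    (hB0 : 0 < B.dim) {K : Type} [Field K] [NumberField K] [IsCMField K] (φ : K →+* B.endAlgebra) (hφ : Function.Bijective φ)
    [Module.Finite ℚ (bettiCohomology B.X 1)] :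
    2 * Module.finrank ℚ
        (BettiUniverse.hodge exists_isReal_hodgeModel_holds (AbelianVariety.isSmoothProjective_holds (A := B)) 1).hodgeLie ≤
      Module.finrank ℚ ↥(Subalgebra.toSubmodule (Subalgebra.centralizer ℚ
          ((BettiUniverse.hodge exists_isReal_hodgeModel_holds (AbelianVariety.isSmoothProjective_holds (A := B)) 1).endAlg :
            Set (Module.End ℚ (bettiCohomology B.X 1))))) := by
  obtain ⟨ψ⟩ := BettiUniverse.hodge_isPolarizable exists_isReal_hodgeModel_holds (AbelianVariety.isSmoothProjective_holds (A := B)) 1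
  rw [← two_mul_finrank_lefschetz_eq_finrank_centralizer_of_isCMField hB0 φ hφ ψ]
  exact Nat.mul_le_mul_left 2
    (Submodule.finrank_mono (hodgeLie_hodge_one_le_lefschetz (AbelianVariety.isSmoothProjective_holds (A := B)) ψ))

/-- **Milne's type IV(e₀, 1) dimension: `dim Lef(ψ) = e₀ · m²`** in the form `2 · dim Lef(ψ) = [K:ℚ] · m²` with
`[K:ℚ] · m = dim_ℚ H¹B`, for `End⁰B` a CM field `K`; and **`2 · dim Lie Hg(H¹B) ≤ [K:ℚ] · m²`**.
[cite: Milne1999LefschetzClasses, §2 and Summary] [cite: MoonenZarhin1999LowDim, §1] -/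
theorem exists_two_mul_finrank_lefschetz_eq_of_isCMField [HodgeTensorFacts.{0, 0}] {B : AbelianVariety ℂ} (hB0 : 0 < B.dim)
    {K : Type} [Field K] [NumberField K] [IsCMField K] (φ : K →+* B.endAlgebra) (hφ : Function.Bijective φ)
    [Module.Finite ℚ (bettiCohomology B.X 1)]
    (ψ : (BettiUniverse.hodge exists_isReal_hodgeModel_holds (AbelianVariety.isSmoothProjective_holds (A := B)) 1).Polarization) :
    ∃ m : ℕ, Module.finrank ℚ K * m = Module.finrank ℚ (bettiCohomology B.X 1) ∧
      2 * Module.finrank ℚ ↥(Subalgebra.toSubmodule (Subalgebra.centralizer ℚ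
          ((BettiUniverse.hodge exists_isReal_hodgeModel_holds (AbelianVariety.isSmoothProjective_holds (A := B)) 1).endAlg :
            Set (Module.End ℚ (bettiCohomology B.X 1)))) ⊓ ψ.form.skewAdjointSubmodule) = Module.finrank ℚ K * (m * m) ∧
      2 * Module.finrank ℚ
          (BettiUniverse.hodge exists_isReal_hodgeModel_holds (AbelianVariety.isSmoothProjective_holds (A := B)) 1).hodgeLie ≤
        Module.finrank ℚ K * (m * m) := by
  obtain ⟨m, hm, hC⟩ := exists_finrank_centralizer_endAlg_eq_of_field φ hφ
  refine ⟨m, hm, ?_, ?_⟩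
  · rw [two_mul_finrank_lefschetz_eq_finrank_centralizer_of_isCMField hB0 φ hφ ψ, hC]
  · rw [← hC]
    exact two_mul_finrank_hodgeLie_le_finrank_centralizer_of_isCMField hB0 φ hφ

/-! ## §2 Two extreme cases: CM fields of degree `2 dim B` (simple CM type) and imaginary quadratic fields (Weil type) -/

/-- **`End⁰B` a CM field of degree `2 dim B`** (e.g. a simple abelian variety of CM type): `dim Lef(ψ) = dim B` (the torus
`U(1)^g`), and **Hodge = Lefschetz (`Lie Hg(H¹B) = Lef(ψ)`) iff `dim MT(H¹B) = dim B + 1`, i.e. iff the CM type is NONDEGENERATE.**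
[cite: Milne1999LefschetzClasses, §2 and Summary] [cite: MoonenZarhin1999LowDim, §1] -/
theorem hodgeLie_eq_lefschetz_iff_of_isCMField_of_finrank_eq_two_mul_dim [HodgeTensorFacts.{0, 0}] {B : AbelianVariety ℂ}
    (hB0 : 0 < B.dim) {K : Type} [Field K] [NumberField K] [IsCMField K] (φ : K →+* B.endAlgebra) (hφ : Function.Bijective φ)
    (hK : Module.finrank ℚ K = 2 * B.dim) [Module.Finite ℚ (bettiCohomology B.X 1)]
    (ψ : (BettiUniverse.hodge exists_isReal_hodgeModel_holds (AbelianVariety.isSmoothProjective_holds (A := B)) 1).Polarization) :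
    Module.finrank ℚ ↥(Subalgebra.toSubmodule (Subalgebra.centralizer ℚ
          ((BettiUniverse.hodge exists_isReal_hodgeModel_holds (AbelianVariety.isSmoothProjective_holds (A := B)) 1).endAlg :
            Set (Module.End ℚ (bettiCohomology B.X 1)))) ⊓ ψ.form.skewAdjointSubmodule) = B.dim ∧
      ((BettiUniverse.hodge exists_isReal_hodgeModel_holds (AbelianVariety.isSmoothProjective_holds (A := B)) 1).hodgeLie = Subalgebra.toSubmodule (Subalgebra.centralizer ℚ
          ((BettiUniverse.hodge exists_isReal_hodgeModel_holds (AbelianVariety.isSmoothProjective_holds (A := B)) 1).endAlg :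
            Set (Module.End ℚ (bettiCohomology B.X 1)))) ⊓ ψ.form.skewAdjointSubmodule ↔
        (BettiUniverse.hodge exists_isReal_hodgeModel_holds (AbelianVariety.isSmoothProjective_holds (A := B)) 1).mtRank = B.dim + 1) := by
  obtain ⟨m, hm, hLef, -⟩ := exists_two_mul_finrank_lefschetz_eq_of_isCMField hB0 φ hφ ψ
  rw [finrank_bettiCohomology_one_eq_two_mul_dim B, hK] at hm
  have hm1 : m = 1 := by
    have h : 2 * B.dim * m = 2 * B.dim * 1 := by rw [hm, mul_one]
    exact Nat.eq_of_mul_eq_mul_left (by omega) h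
  rw [hK, hm1, mul_one, mul_one] at hLef
  have hL : Module.finrank ℚ ↥(Subalgebra.toSubmodule (Subalgebra.centralizer ℚ
          ((BettiUniverse.hodge exists_isReal_hodgeModel_holds (AbelianVariety.isSmoothProjective_holds (A := B)) 1).endAlg :
            Set (Module.End ℚ (bettiCohomology B.X 1)))) ⊓ ψ.form.skewAdjointSubmodule) = B.dim := by omega
  refine ⟨hL, ?_⟩
  have ht := mtRank_hodge_one_eq_finrank_hodgeLie_add_one (AbelianVariety.isSmoothProjective_holds (A := B)) hB0
  refine ⟨fun h => by rw [ht, h, hL], fun h => Submodule.eq_of_le_of_finrank_eq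
    (hodgeLie_hodge_one_le_lefschetz (AbelianVariety.isSmoothProjective_holds (A := B)) ψ) ?_⟩
  rw [hL]
  omega

/-- **`End⁰B` an IMAGINARY QUADRATIC field** (e.g. abelian varieties of Weil type): `dim Lef(ψ) = (dim B)²` (the unitary Lie
algebra `𝔲(p, q)`, `p + q = dim B`) and `dim MT(H¹B) ≤ (dim B)² + 1`. [cite: Milne1999LefschetzClasses, §2 and Summary]
[cite: MoonenZarhin1999LowDim, §1, (2.4)] -/
theorem finrank_lefschetz_eq_sq_of_isCMField_of_finrank_eq_two [HodgeTensorFacts.{0, 0}] {B : AbelianVariety ℂ}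
    (hB0 : 0 < B.dim) {K : Type} [Field K] [NumberField K] [IsCMField K] (φ : K →+* B.endAlgebra) (hφ : Function.Bijective φ)
    (hK : Module.finrank ℚ K = 2) [Module.Finite ℚ (bettiCohomology B.X 1)]
    (ψ : (BettiUniverse.hodge exists_isReal_hodgeModel_holds (AbelianVariety.isSmoothProjective_holds (A := B)) 1).Polarization) :
    Module.finrank ℚ ↥(Subalgebra.toSubmodule (Subalgebra.centralizer ℚ
          ((BettiUniverse.hodge exists_isReal_hodgeModel_holds (AbelianVariety.isSmoothProjective_holds (A := B)) 1).endAlg :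
            Set (Module.End ℚ (bettiCohomology B.X 1)))) ⊓ ψ.form.skewAdjointSubmodule) = B.dim * B.dim ∧
      (BettiUniverse.hodge exists_isReal_hodgeModel_holds (AbelianVariety.isSmoothProjective_holds (A := B)) 1).mtRank ≤
        B.dim * B.dim + 1 := by
  obtain ⟨m, hm, hLef, hHg⟩ := exists_two_mul_finrank_lefschetz_eq_of_isCMField hB0 φ hφ ψ
  rw [finrank_bettiCohomology_one_eq_two_mul_dim B, hK] at hm
  have hm1 : m = B.dim := by omega
  subst hm1
  rw [hK] at hLef hHg
  have ht := mtRank_hodge_one_eq_finrank_hodgeLie_add_one (AbelianVariety.isSmoothProjective_holds (A := B)) hB0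
  constructor <;> omega

/-! ## §3 Simple abelian varieties of CM type, intrinsically -/

/-- **A SIMPLE complex abelian variety of CM type: `dim Lef(ψ) = dim B`, and Hodge = Lefschetz (`Lie Hg(H¹B) = Lef(ψ)`) iff
`dim MT(H¹B) = dim B + 1` (nondegenerate CM type)** — `End⁰B` is a CM field of degree `2 dim B` (the tree's
`isCMField_endField_of_isSimple_of_riemann`, Riemann's theorem discharged by `deligneMilne1982_Thm_6_20_full_holds`) and §2 applies.
[cite: Milne1999LefschetzClasses, §2 and Summary] [cite: Shimura1998, §5.1 Proposition 5, §5.2] [cite: MoonenZarhin1999LowDim, §1] -/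
theorem hodgeLie_eq_lefschetz_iff_of_isSimple_of_isOfCMType [HodgeTensorFacts.{0, 0}] {B : AbelianVariety ℂ} (hBs : B.IsSimple)
    (hB0 : 0 < B.dim) (hcm : IsOfCMType B) [Module.Finite ℚ (bettiCohomology B.X 1)]
    (ψ : (BettiUniverse.hodge exists_isReal_hodgeModel_holds (AbelianVariety.isSmoothProjective_holds (A := B)) 1).Polarization) :
    Module.finrank ℚ ↥(Subalgebra.toSubmodule (Subalgebra.centralizer ℚ
          ((BettiUniverse.hodge exists_isReal_hodgeModel_holds (AbelianVariety.isSmoothProjective_holds (A := B)) 1).endAlg :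
            Set (Module.End ℚ (bettiCohomology B.X 1)))) ⊓ ψ.form.skewAdjointSubmodule) = B.dim ∧
      ((BettiUniverse.hodge exists_isReal_hodgeModel_holds (AbelianVariety.isSmoothProjective_holds (A := B)) 1).hodgeLie = Subalgebra.toSubmodule (Subalgebra.centralizer ℚ
          ((BettiUniverse.hodge exists_isReal_hodgeModel_holds (AbelianVariety.isSmoothProjective_holds (A := B)) 1).endAlg :
            Set (Module.End ℚ (bettiCohomology B.X 1)))) ⊓ ψ.form.skewAdjointSubmodule ↔
        (BettiUniverse.hodge exists_isReal_hodgeModel_holds (AbelianVariety.isSmoothProjective_holds (A := B)) 1).mtRank = B.dim + 1) := by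
  have hS := hcm.isOfCMTypeSimple hBs hB0
  haveI : IsCMField (EndField B hS.1) :=
    isCMField_endField_of_isSimple_of_riemann deligneMilne1982_Thm_6_20_full_holds hBs hB0 hcm
  exact hodgeLie_eq_lefschetz_iff_of_isCMField_of_finrank_eq_two_mul_dim hB0 (EndField.toEndAlgebra hS.1).toRingHom
    (EndField.toEndAlgebra hS.1).bijective (by rw [EndField.finrank_eq, hS.2]) ψ

/-- **Hodge = Lefschetz for simple CM abelian varieties of dimension `≤ 3` or of prime dimension** (Ribet 1980 (3.7), Yanai 1985:
they are nondegenerate, `t = dim B + 1`, the tree's `Pohlmann1968.mtRank_hodge_one_eq_of_dim_le_three` / `…_of_prime`):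
`Lie Hg(H¹B) = C(End_Hdg(H¹B)) ∩ 𝔰𝔭(ψ)` for every polarization. [cite: Ribet1980, §3 Examples (3.7)] [cite: Yanai1985, §4 Theorem]
[cite: Milne1999LefschetzClasses, §2 and Summary] -/
theorem hodgeLie_eq_lefschetz_of_isSimple_of_isOfCMType_of_dim_le_three_or_prime [HodgeTensorFacts.{0, 0}] {B : AbelianVariety ℂ}
    (hBs : B.IsSimple) (hB0 : 0 < B.dim) (hcm : IsOfCMType B) (h3p : B.dim ≤ 3 ∨ B.dim.Prime)
    [Module.Finite ℚ (bettiCohomology B.X 1)]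
    (ψ : (BettiUniverse.hodge exists_isReal_hodgeModel_holds (AbelianVariety.isSmoothProjective_holds (A := B)) 1).Polarization) :
    (BettiUniverse.hodge exists_isReal_hodgeModel_holds (AbelianVariety.isSmoothProjective_holds (A := B)) 1).hodgeLie = Subalgebra.toSubmodule (Subalgebra.centralizer ℚ
          ((BettiUniverse.hodge exists_isReal_hodgeModel_holds (AbelianVariety.isSmoothProjective_holds (A := B)) 1).endAlg :
            Set (Module.End ℚ (bettiCohomology B.X 1)))) ⊓ ψ.form.skewAdjointSubmodule := by
  refine ((hodgeLie_eq_lefschetz_iff_of_isSimple_of_isOfCMType hBs hB0 hcm ψ).2).2 ?_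
  rcases h3p with h3 | hp
  · exact Literature.AlgebraicGeometry.Pohlmann1968.mtRank_hodge_one_eq_of_dim_le_three
      (AbelianVariety.isSmoothProjective_holds (A := B)) hBs hB0 h3 hcm
  · exact Literature.AlgebraicGeometry.Pohlmann1968.mtRank_hodge_one_eq_of_prime
      (AbelianVariety.isSmoothProjective_holds (A := B)) hBs hcm hp rfl

/-! ## §4 Simple CM abelian varieties: Hodge = Lefschetz ⟺ all powers divisor-generated; fourfolds -/
open Literature.AlgebraicGeometry in
/-- **For a SIMPLE abelian variety of CM type, Hodge = Lefschetz at the level of Lie algebras iff every power is divisor-generated**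
— Milne's Prop. 4.8 in the simple CM case, through Hazama's criterion (`Pohlmann1968.forall_isDivisorGenerated_powSucc_iff_mtRank_eq`)
and §3. [cite: Milne1999LefschetzClasses, Prop. 4.8] [cite: Hazama1983, Theorem] [cite: Gordon1999HodgeAVSurvey, Thm. 6.4] -/
theorem hodgeLie_eq_lefschetz_iff_forall_isDivisorGenerated_powSucc_of_isSimple_of_isOfCMType [HodgeTensorFacts.{0, 0}]
    {B : AbelianVariety ℂ} (hBs : B.IsSimple) (hB0 : 0 < B.dim) (hcm : IsOfCMType B) [Module.Finite ℚ (bettiCohomology B.X 1)]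
    (ψ : (BettiUniverse.hodge exists_isReal_hodgeModel_holds (AbelianVariety.isSmoothProjective_holds (A := B)) 1).Polarization) :
    (BettiUniverse.hodge exists_isReal_hodgeModel_holds (AbelianVariety.isSmoothProjective_holds (A := B)) 1).hodgeLie = Subalgebra.toSubmodule (Subalgebra.centralizer ℚ
          ((BettiUniverse.hodge exists_isReal_hodgeModel_holds (AbelianVariety.isSmoothProjective_holds (A := B)) 1).endAlg :
            Set (Module.End ℚ (bettiCohomology B.X 1)))) ⊓ ψ.form.skewAdjointSubmodule ↔
      ∀ N : ℕ, IsDivisorGenerated (B.powSucc N) := by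
  rw [(hodgeLie_eq_lefschetz_iff_of_isSimple_of_isOfCMType hBs hB0 hcm ψ).2,
    Pohlmann1968.forall_isDivisorGenerated_powSucc_iff_mtRank_eq (AbelianVariety.isSmoothProjective_holds (A := B)) hBs hB0 hcm]

open Literature.AlgebraicGeometry in
/-- **Simple CM abelian FOURFOLDS: `dim MT(H¹B) ∈ {4, 5}`** (`4·dim B ≤ 2^t`, `t ≤ dim B + 1`), Hodge = Lefschetz iff `t = 5`.
[cite: Dodson1987, Thm. 1.0 (iii)] [cite: Ribet1980, §3 (3.5)] [cite: MoonenZarhin1999LowDim, §1] -/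
theorem mtRank_hodge_one_mem_of_isSimple_fourfold_of_isOfCMType [HodgeTensorFacts.{0, 0}] {B : AbelianVariety ℂ}
    (hBs : B.IsSimple) (hB4 : B.dim = 4) (hcm : IsOfCMType B) [Module.Finite ℚ (bettiCohomology B.X 1)]
    (ψ : (BettiUniverse.hodge exists_isReal_hodgeModel_holds (AbelianVariety.isSmoothProjective_holds (A := B)) 1).Polarization) :
    ((BettiUniverse.hodge exists_isReal_hodgeModel_holds (AbelianVariety.isSmoothProjective_holds (A := B)) 1).mtRank = 4 ∨
        (BettiUniverse.hodge exists_isReal_hodgeModel_holds (AbelianVariety.isSmoothProjective_holds (A := B)) 1).mtRank = 5) ∧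
      ((BettiUniverse.hodge exists_isReal_hodgeModel_holds (AbelianVariety.isSmoothProjective_holds (A := B)) 1).hodgeLie = Subalgebra.toSubmodule (Subalgebra.centralizer ℚ
          ((BettiUniverse.hodge exists_isReal_hodgeModel_holds (AbelianVariety.isSmoothProjective_holds (A := B)) 1).endAlg :
            Set (Module.End ℚ (bettiCohomology B.X 1)))) ⊓ ψ.form.skewAdjointSubmodule ↔
        (BettiUniverse.hodge exists_isReal_hodgeModel_holds (AbelianVariety.isSmoothProjective_holds (A := B)) 1).mtRank = 5) := by
  have hB0 : 0 < B.dim := by omega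
  have hlow := Pohlmann1968.four_mul_dim_le_two_pow_mtRank (AbelianVariety.isSmoothProjective_holds (A := B)) hBs hB0 hcm
  have hup := Pohlmann1968.mtRank_hodge_one_le_dim_add_one (AbelianVariety.isSmoothProjective_holds (A := B)) hBs hB0 hcm
  have h4 := (Nat.pow_le_pow_iff_right (by norm_num : 1 < 2)).1 (le_trans (by norm_num [hB4]) hlow : 2 ^ 4 ≤ 2 ^ _)
  exact ⟨by omega, (hodgeLie_eq_lefschetz_iff_of_isSimple_of_isOfCMType hBs hB0 hcm ψ).2.trans ⟨fun h => by omega,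
    fun h => by omega⟩⟩

end Summit.HodgeConjecture.CorCM

end
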